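import Mathlib
import Literature.NumberTheory.LFunctions.Zhang2022.SkeletonPartThree
import Literature.NumberTheory.LFunctions.Zhang2022.TypedAppendixB
import Literature.NumberTheory.Sieve.DivisorBound

/-!
# Zhang (2022) Appendix B ⇒ Lemma 15.1: arithmetic preliminaries for the assembly — `𝔮`, `𝔫(𝔮)`,
# the `χ`-twist identity, divisor pairs, and the `ϱ*_j ↦ ϱ_j` swap from (B.1)–(B.2) for any weight

Topic `Literature/NumberTheory/LFunctions/Zhang2022` (Landau–Siegel audit tree; verdict-neutral).
Y. Zhang, *Discrete mean estimates and the Landau–Siegel zero*, arXiv:2211.02515v1 (2022)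
[Zhang2022LandauSiegel] — **an unrefereed manuscript under adjudication; nothing in this file
asserts any claim of the manuscript.** Cell siegel-zhang (D-0069), DISCHARGE row D16 (cone C37,
Lemma 15.1 = `Skeleton.Lemma151` / χ-twisted `Skeleton.Lemma151Chi`), DAG node `Z22:Lem15.1.pf`
[Z22 App. B pp.106–108, tex L5248–5339]. Everything here is PROVED (theorems only, 0 definitions):

* `prime_dvd_frakq`, `coprime_of_coprime_frakq` — `𝔮 = ∏_{q<D⁴} q` (§15 p. 85): `(n,𝔮)=1 ⇒ (n,D)=1`;
* `chi_sq_eq_one`, `chi_mul_mul_chi_eq` — for `χ` real and `(n,D) = 1`: `χ(n)² = 1`, hence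
  **`χ(n₁n)χ(n) = χ(n₁)`** — the identity behind the cell's χ-twisted reading of Lemma 15.1
  (gap row G-L4t1-1, `SkeletonChiTwist`): the twisted sum is `χ(n₁)·Σ_{(n,𝔮)=1} b(n₁n)ϱ*_j(n)/n`;
* `mem_nset_of_dvd`, `coprime_of_mem_nset` (divisors of `n₁ ∈ 𝔫(𝔮)`; `(n₁, n) = 1` for `(n,𝔮) = 1`);
* `norm_coprimeSum_sub_vkSum_le` — **"By (B.1) and (B.2)"** (§B.u006, tex L5282) for an ARBITRARY
  weight `|ϰ| ≤ 1` (the manuscript states the swap for `ϰ₂, ϰ₃` and uses it silently for `ϰ₁`): at a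
  modulus where the (B.1)-sum is `≤ B₁` and the (B.2)-sum `≤ B₂`,
  `|Σ_{l<P,(l,𝔮)=1} ϰ(l₁l)ϱ*_j(l)/l − Σ_{l<P} ϰ(l₁l)ϱ_j(l)/l| ≤ B₁ + B₂` (`Σ_l ϰ(l₁l)ϱ_j(l)/l` =
  L4-t10's `Typed.AppendixB.vkSum`);
* `hmu1_of_u012_B3` — **the `μ = 1` evaluation on the TRUNCATED weight `ϰ₁·[· < P^{1/2}]` of `b`**
  ((15.1), `Skeleton.bcoef`), i.e. "`e_{1j} = e′_{1j} − e″_{1j}`" (`Section18Defs.e1j`), as a kernel edge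
  from the typed nodes `StepB_u012` ("The same argument also gives `Σ_l ϰ₁(l₁l)ϱ_j(l)/l = e′_{1j} +
  O(α₁)`", tex L5311) and `EqB_3` ((B.3), the tail `l > P^{1/2}/l₁`, `= e″_{1j} + O(α₁)`): full sum
  minus tail; the single boundary term `l₁l = P^{1/2}` left between the two cut conventions
  (`bcoef`: `l₁l < P^{1/2}`; `tailB3`: `l > P^{1/2}/l₁`) is PROVED negligible: `≤ τ₂(l)/l ≤ C_τl^{−7/8}`
  with `l ≥ P^{1/2}/T ≥ D³` (`cube_le_sqrtP_div_T`), and `𝓛⁸ ≤ (64/21)⁸D^{21/8}`, so `≪ α𝓛`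
  (divisor bound: the tree's `Sieve.exists_card_divisors_le_mul_rpow'`, Hardy–Wright Thm 315).

WHAT THIS IS NOT: any claim about (B.1), (B.2), Lemma 15.1, Theorems 1–2 or Landau–Siegel zeros.

## References

* Y. Zhang, arXiv:2211.02515v1 (2022), §15 Lemma 15.1 (p. 86), (15.21) `ϱ*_j`; Appendix B
  (B.1)–(B.3), pp. 106–108. [cite: Zhang2022LandauSiegel, App. B (B.1)–(B.3)]
* G. H. Hardy, E. M. Wright, *An Introduction to the Theory of Numbers*, Thm 315 (divisor bound;
  the tree's `Sieve.exists_card_divisors_le_mul_rpow'`). [cite: HardyWright2008, Theorem 315]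
-/

noncomputable section

open Complex Real ComplexConjugate

namespace Literature.NumberTheory.LFunctions.Zhang2022.Skeleton

open Typed.AppendixB (varrhoJ vkSum tailB3)

/-! ## Arithmetic preliminaries: `𝔮`, `𝔫(𝔮)`, the twist, divisor pairs -/

section Arithmetic

variable {D : ℕ}

/-- A prime `p < D⁴` divides `𝔮 = ∏_{q<D⁴} q`. [cite: Zhang2022LandauSiegel, §15 p. 85] -/
theorem prime_dvd_frakq {p : ℕ} (hp : p.Prime) (hpD : p < D ^ 4) : p ∣ frakq D :=
  Finset.dvd_prod_of_mem _ (Finset.mem_filter.mpr ⟨Finset.mem_range.mpr hpD, hp⟩)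

/-- **`(n,𝔮) = 1 ⇒ (n,D) = 1`** (`D ≥ 2`: every prime factor of `D` is `< D⁴`, hence divides `𝔮`).
[cite: Zhang2022LandauSiegel, §15 p. 85] -/
theorem coprime_of_coprime_frakq (hD : 2 ≤ D) {n : ℕ} (h : Nat.Coprime n (frakq D)) :
    Nat.Coprime n D := by
  refine Nat.coprime_of_dvd fun p hp hpn hpD => ?_
  have hpD' : p < D ^ 4 := by
    calc p ≤ D := Nat.le_of_dvd (by omega) hpD
      _ < D ^ 4 := by
        calc D = D ^ 1 := (pow_one D).symm
          _ < D ^ 4 := Nat.pow_lt_pow_right (by omega) (by norm_num)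
  exact (Nat.Prime.one_lt hp).ne'
    ((Nat.Coprime.coprime_dvd_left hpn h).eq_one_of_dvd (prime_dvd_frakq hp hpD'))

/-- For `χ` real (quadratic) and `(n,D) = 1`: `χ(n)² = 1` ("`χ` is a real primitive character", §1;
used at Lemma 15.1 through `χ(n₁n)χ(n) = χ(n₁)`). [cite: Zhang2022LandauSiegel, §15 Lemma 15.1] -/
theorem chi_sq_eq_one [NeZero D] {χ : DirichletCharacter ℂ D} (hq : χ.IsQuadratic) {n : ℕ}
    (hn : Nat.Coprime n D) : χ (n : ZMod D) ^ 2 = 1 := by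
  have hu : ‖χ (n : ZMod D)‖ = 1 := by
    have := χ.unit_norm_eq_one (ZMod.unitOfCoprime n hn)
    rwa [ZMod.coe_unitOfCoprime] at this
  rcases hq (n : ZMod D) with h0 | h1 | h1
  · rw [h0, norm_zero] at hu; exact absurd hu zero_ne_one
  · rw [h1, one_pow]
  · rw [h1]; norm_num

/-- **The twist**: `χ(n₁n)·χ(n) = χ(n₁)` for `(n,D) = 1`, `χ` real. [cite: Zhang2022LandauSiegel, §15 Lemma 15.1] -/
theorem chi_mul_mul_chi_eq [NeZero D] {χ : DirichletCharacter ℂ D} (hq : χ.IsQuadratic) (n₁ : ℕ)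
    {n : ℕ} (hn : Nat.Coprime n D) :
    χ ((n₁ * n : ℕ) : ZMod D) * χ (n : ZMod D) = χ (n₁ : ZMod D) := by
  rw [Nat.cast_mul, map_mul, mul_assoc, ← sq, chi_sq_eq_one hq hn, mul_one]

/-- A divisor of a member of `𝔫(d)` is in `𝔫(d)`. [cite: Zhang2022LandauSiegel, §7 p. 14] -/
theorem mem_nset_of_dvd {d n m : ℕ} (hn : n ∈ nset d) (hm : m ∣ n) : m ∈ nset d := by
  refine ⟨Nat.pos_of_dvd_of_pos hm hn.1, fun q hq hqm => hn.2 q hq (hqm.trans hm)⟩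

/-- `n₁ ∈ 𝔫(𝔮)` and `(n,𝔮) = 1` ⇒ `(n₁,n) = 1`. [cite: Zhang2022LandauSiegel, §15 p. 85] -/
theorem coprime_of_mem_nset {n₁ n : ℕ} (hn₁ : n₁ ∈ nset (frakq D))
    (hn : Nat.Coprime n (frakq D)) : Nat.Coprime n₁ n := by
  refine Nat.coprime_of_dvd fun p hp hp₁ hpn => ?_
  exact (Nat.Prime.one_lt hp).ne'
    ((Nat.Coprime.coprime_dvd_left hpn hn).eq_one_of_dvd (hn₁.2 p hp hp₁))

end Arithmetic

/-! ## The `ϱ*_j ↦ ϱ_j` swap for any bounded weight, from (B.1) and (B.2) -/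

section Swap

variable (c' : ℝ) {D : ℕ} (χ : DirichletCharacter ℂ D)

/-- **"By (B.1) and (B.2)"** for an ARBITRARY weight `|vk| ≤ 1` (the manuscript: `ϰ₂, ϰ₃`; used also
for `ϰ₁`): at a modulus where the (B.1)-sum is `≤ B₁` and the (B.2)-sum is `≤ B₂`,
`|Σ_{l<P,(l,𝔮)=1} vk(l₁l)ϱ*_j(l)/l − Σ_{l<P} vk(l₁l)ϱ_j(l)/l| ≤ B₁ + B₂`.
[cite: Zhang2022LandauSiegel, App. B p. 107 (tex L5282)] -/
theorem norm_coprimeSum_sub_vkSum_le {j l₁ : ℕ} {vk : ℕ → ℂ} (hvk : ∀ m, ‖vk m‖ ≤ 1) {B₁ B₂ : ℝ}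
    (hB1 : ∑ n ∈ (Finset.Ico 1 ⌈bigP D⌉₊).filter (fun n => Nat.Coprime n (frakq D)),
        ‖varrhoJ c' D j n - varrhoStar c' χ j n‖ / (n : ℝ) ≤ B₁)
    (hB2 : ∑ n ∈ (Finset.Ico 1 ⌈bigP D⌉₊).filter (fun n => ¬ Nat.Coprime n (frakq D)),
        ‖varrhoJ c' D j n‖ / (n : ℝ) ≤ B₂) :
    ‖(∑ l ∈ (Finset.Ico 1 ⌈bigP D⌉₊).filter (fun n => Nat.Coprime n (frakq D)),
        vk (l₁ * l) * varrhoStar c' χ j l / (l : ℂ)) - vkSum c' D vk j l₁‖ ≤ B₁ + B₂ := by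
  set R := Finset.Ico 1 ⌈bigP D⌉₊ with hR
  have hsplit : vkSum c' D vk j l₁ =
      (∑ l ∈ R.filter (fun n => Nat.Coprime n (frakq D)), vk (l₁ * l) * varrhoJ c' D j l / (l : ℂ)) +
      ∑ l ∈ R.filter (fun n => ¬ Nat.Coprime n (frakq D)), vk (l₁ * l) * varrhoJ c' D j l / (l : ℂ) := by
    rw [vkSum, hR]
    exact (Finset.sum_filter_add_sum_filter_not _ _ _).symm
  rw [hsplit, ← sub_sub, ← Finset.sum_sub_distrib]
  refine (norm_sub_le _ _).trans (add_le_add ?_ ?_)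
  · refine (norm_sum_le _ _).trans (le_trans (Finset.sum_le_sum fun l hl => ?_) hB1)
    rw [← sub_div, ← mul_sub, norm_div, norm_mul, Complex.norm_natCast, ← neg_sub, norm_neg]
    have hl0 : (0 : ℝ) ≤ l := Nat.cast_nonneg l
    calc ‖vk (l₁ * l)‖ * ‖varrhoJ c' D j l - varrhoStar c' χ j l‖ / (l : ℝ)
        ≤ 1 * ‖varrhoJ c' D j l - varrhoStar c' χ j l‖ / (l : ℝ) := by gcongr; exact hvk _
      _ = _ := by rw [one_mul]
  · refine (norm_sum_le _ _).trans (le_trans (Finset.sum_le_sum fun l hl => ?_) hB2)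
    rw [norm_div, norm_mul, Complex.norm_natCast]
    calc ‖vk (l₁ * l)‖ * ‖varrhoJ c' D j l‖ / (l : ℝ)
        ≤ 1 * ‖varrhoJ c' D j l‖ / (l : ℝ) := by gcongr; exact hvk _
      _ = _ := by rw [one_mul]

end Swap


/-! ## The `μ = 1` truncated evaluation from `StepB_u012` and (B.3) -/

section MuOne

variable (c' : ℝ)

/-- `|ϱ_j(l)| ≤ τ₂(l)` (`|μ(d)| ≤ 1`, `|d^{β_j}| = 1` as `Re β_j = 0`). [cite: Zhang2022LandauSiegel, App. B p.106] -/
theorem norm_varrhoJ_le (D j l : ℕ) : ‖varrhoJ c' D j l‖ ≤ l.divisors.card := by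
  unfold varrhoJ
  refine (norm_sum_le _ _).trans ?_
  have : ∀ d ∈ l.divisors, ‖(ArithmeticFunction.moebius d : ℂ) * (d : ℂ) ^ betaJ c' D j‖ ≤ 1 := by
    intro d hd
    have hd0 : 0 < d := Nat.pos_of_mem_divisors hd
    rw [norm_mul, Complex.norm_natCast_cpow_of_pos hd0, Typed.AppendixB.betaJ_re, Real.rpow_zero,
      mul_one, Complex.norm_intCast]
    exact_mod_cast ArithmeticFunction.abs_moebius_le_one
  calc ∑ d ∈ l.divisors, ‖(ArithmeticFunction.moebius d : ℂ) * (d : ℂ) ^ betaJ c' D j‖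
      ≤ ∑ _d ∈ l.divisors, (1 : ℝ) := Finset.sum_le_sum this
    _ = l.divisors.card := by simp

/-- `P^{1/2}/T ≥ D³` for `𝓛 ≥ 2` (`P^{1/2}/T = exp(𝓛⁹/2 − 𝓛^{1.1})`, `𝓛^{1.1} ≤ 𝓛²`, `exp(3𝓛) = D³`).
[cite: Zhang2022LandauSiegel, §2 (2.6), §6] -/
theorem cube_le_sqrtP_div_T {D : ℕ} (hℓ : 2 ≤ ell D) :
    (D : ℝ) ^ 3 ≤ bigP D ^ (1 / 2 : ℝ) / bigT D := by
  have hℓ1 : 1 ≤ ell D := by linarith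
  have hD0 : (0 : ℝ) < D := by
    have : 0 < ell D := by linarith
    rw [ell] at this
    by_contra h
    push Not at h
    have hD : (D : ℝ) = 0 := le_antisymm h (Nat.cast_nonneg D)
    rw [hD, Real.log_zero] at this
    exact lt_irrefl _ this
  have h11 : ell D ^ (1.1 : ℝ) ≤ ell D ^ 2 := by
    calc ell D ^ (1.1 : ℝ) ≤ ell D ^ (2 : ℝ) :=
          Real.rpow_le_rpow_of_exponent_le hℓ1 (by norm_num)
      _ = ell D ^ 2 := by norm_cast
  have hexp : bigP D ^ (1 / 2 : ℝ) / bigT D = Real.exp (ell D ^ 9 / 2 - ell D ^ (1.1 : ℝ)) := by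
    rw [bigP, bigT, ← Real.exp_mul, Real.exp_sub]; ring_nf
  have hD3 : (D : ℝ) ^ 3 = Real.exp (3 * ell D) := by
    rw [ell, show (3 : ℝ) * Real.log D = Real.log ((D : ℝ) ^ 3) by
      rw [Real.log_pow]; norm_num, Real.exp_log (pow_pos hD0 3)]
  rw [hexp, hD3, Real.exp_le_exp]
  have hℓ7 : (128 : ℝ) ≤ ell D ^ 7 := by
    calc (128 : ℝ) = 2 ^ 7 := by norm_num
      _ ≤ ell D ^ 7 := by gcongr
  have h9 : ell D ^ 9 = ell D ^ 2 * ell D ^ 7 := by ring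
  have h2 : 0 < ell D ^ 2 := by positivity
  have hmain : 128 * ell D ^ 2 ≤ ell D ^ 9 := by
    rw [h9]; nlinarith [mul_le_mul_of_nonneg_left hℓ7 h2.le]
  nlinarith

/-- **The `μ = 1` truncated evaluation from `StepB_u012` and (B.3)**: "`e_{1j} = e′_{1j} − e″_{1j}`"
on the weight `ϰ₁·[· < P^{1/2}]` of `b` (the boundary term `l₁l = P^{1/2}` is absorbed: it is
`≪ l^{−7/8} ≤ D^{−21/8} ≪ 𝓛⁻⁸`). Supplies `hmu1` of `lemma151Chi_of_parts`.
[cite: Zhang2022LandauSiegel, App. B (B.3), p.107–108] -/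
theorem hmu1_of_u012_B3 (h12 : Typed.AppendixB.StepB_u012 c') (hB3 : Typed.AppendixB.EqB_3 c') :
    ∃ C : ℝ, ForAllLarge fun D _ _ => ∀ j ∈ ({1, 2, 3} : Finset ℕ), ∀ l₁ : ℕ, 1 ≤ l₁ →
      l₁ ∈ nset (frakq D) → (l₁ : ℝ) < bigT D →
        ‖vkSum c' D (fun m => if (m : ℝ) < bigP D ^ (1 / 2 : ℝ) then vk1 D m else 0) j l₁ -
            e1j j‖ ≤ C * alpha D * ell D := by
  obtain ⟨C₁, h₁⟩ := h12
  obtain ⟨C₂, h₂⟩ := hB3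
  obtain ⟨Cd, hCd1, hCd⟩ := Sieve.exists_card_divisors_le_mul_rpow' (by norm_num : (0 : ℝ) < 1 / 8)
  set ε : ℝ := 21 / 64 with hε
  obtain ⟨D₀, h⟩ := h₁.and h₂
  refine ⟨C₁ + C₂ + Cd * ε⁻¹ ^ 8 / π, max D₀ 8, fun D _ χ hD hq hp j hj l₁ hl₁ hl₁n hl₁T => ?_⟩
  obtain ⟨e₁, e₂⟩ := h D χ (le_trans (le_max_left _ _) hD) hq hp
  have hD8 : 8 ≤ D := le_trans (le_max_right _ _) hD
  have hD0 : (0 : ℝ) < D := by exact_mod_cast (show 0 < D by omega)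
  have hlog : 2 ≤ Real.log D := by
    have h8 : (8 : ℝ) ≤ D := by exact_mod_cast hD8
    have he2 : Real.exp 2 ≤ 8 := by
      have hh : Real.exp 2 = Real.exp 1 * Real.exp 1 := by rw [← Real.exp_add]; norm_num
      rw [hh]; nlinarith [Real.exp_one_lt_d9, Real.exp_pos 1]
    calc (2 : ℝ) = Real.log (Real.exp 2) := (Real.log_exp 2).symm
      _ ≤ Real.log 8 := Real.log_le_log (Real.exp_pos _) he2
      _ ≤ Real.log D := Real.log_le_log (by norm_num) h8
  have hℓ2 : 2 ≤ ell D := hlog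
  have hℓ0 : 0 < ell D := by linarith
  have g₁ := e₁ j hj l₁ hl₁ hl₁n hl₁T
  have g₂ := e₂ j hj l₁ hl₁ hl₁n hl₁T
  -- notation
  set y : ℝ := bigP D ^ (1 / 2 : ℝ) with hy
  have hy0 : 0 < y := Real.rpow_pos_of_pos (Real.exp_pos _) _
  have hl₁0 : (0 : ℝ) < l₁ := by exact_mod_cast hl₁
  set R₀ : Finset ℕ := Finset.Ico 1 ⌈bigP D⌉₊ with hR₀
  set F : ℕ → ℂ := fun l => vk1 D (l₁ * l) * varrhoJ c' D j l / (l : ℂ) with hF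
  -- the three pieces of the full `ϰ₁`-sum
  have hfull : vkSum c' D (vk1 D) j l₁ =
      (∑ l ∈ R₀.filter (fun l : ℕ => ((l₁ * l : ℕ) : ℝ) < y), F l) +
      ((∑ l ∈ R₀.filter (fun l : ℕ => ((l₁ * l : ℕ) : ℝ) = y), F l) + tailB3 c' D j l₁) := by
    rw [vkSum, tailB3, ← hR₀]
    rw [← Finset.sum_filter_add_sum_filter_not R₀ (fun l : ℕ => ((l₁ * l : ℕ) : ℝ) < y)]
    congr 1
    rw [← Finset.sum_filter_add_sum_filter_not (R₀.filter fun l : ℕ => ¬ ((l₁ * l : ℕ) : ℝ) < y)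
      (fun l : ℕ => ((l₁ * l : ℕ) : ℝ) = y), Finset.filter_filter, Finset.filter_filter]
    congr 1
    · refine Finset.sum_congr (Finset.filter_congr fun l _ => ?_) fun _ _ => rfl
      constructor
      · rintro ⟨-, h⟩; exact h
      · intro h; exact ⟨by rw [h]; exact lt_irrefl _, h⟩
    · refine Finset.sum_congr (Finset.filter_congr fun l _ => ?_) fun _ _ => rfl
      rw [Nat.cast_mul, div_lt_iff₀' hl₁0]
      constructor
      · rintro ⟨h1, h2⟩; exact lt_of_le_of_ne (not_lt.mp h1) (Ne.symm h2)
      · intro h; exact ⟨not_lt.mpr h.le, ne_of_gt h⟩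
  have htrunc : vkSum c' D (fun m => if (m : ℝ) < bigP D ^ (1 / 2 : ℝ) then vk1 D m else 0) j l₁ =
      ∑ l ∈ R₀.filter (fun l : ℕ => ((l₁ * l : ℕ) : ℝ) < y), F l := by
    rw [vkSum, ← hR₀, Finset.sum_filter]
    refine Finset.sum_congr rfl fun l _ => ?_
    simp only [hF, hy]
    split_ifs <;> simp
  -- the boundary term
  have hbd : ‖∑ l ∈ R₀.filter (fun l : ℕ => ((l₁ * l : ℕ) : ℝ) = y), F l‖ ≤
      Cd * ε⁻¹ ^ 8 / π * (alpha D * ell D) := by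
    have hcard : (R₀.filter (fun l : ℕ => ((l₁ * l : ℕ) : ℝ) = y)).card ≤ 1 := by
      refine Finset.card_le_one.mpr fun a ha b hb => ?_
      have ha' := (Finset.mem_filter.mp ha).2
      have hb' := (Finset.mem_filter.mp hb).2
      have : ((l₁ * a : ℕ) : ℝ) = ((l₁ * b : ℕ) : ℝ) := by rw [ha', hb']
      have : l₁ * a = l₁ * b := by exact_mod_cast this
      exact Nat.eq_of_mul_eq_mul_left hl₁ this
    -- bound for the (at most one) term
    have hterm : ∀ l ∈ R₀.filter (fun l : ℕ => ((l₁ * l : ℕ) : ℝ) = y),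
        ‖F l‖ ≤ Cd * ε⁻¹ ^ 8 / π * (alpha D * ell D) := by
      intro l hl
      obtain ⟨hlR, hly⟩ := Finset.mem_filter.mp hl
      have hl1 : 1 ≤ l := (Finset.mem_Ico.mp hlR).1
      have hl0 : (0 : ℝ) < l := by exact_mod_cast hl1
      -- `l ≥ y/T ≥ D³`
      have hlD : (D : ℝ) ^ 3 ≤ l := by
        have h1 : y / bigT D ≤ y / l₁ :=
          div_le_div_of_nonneg_left hy0.le hl₁0 hl₁T.le
        have h2 : y / l₁ = l := by
          rw [div_eq_iff hl₁0.ne', mul_comm]; exact_mod_cast hly.symm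
        calc (D : ℝ) ^ 3 ≤ y / bigT D := cube_le_sqrtP_div_T hℓ2
          _ ≤ l := by rw [← h2]; exact h1
      have hD1 : (1 : ℝ) ≤ D := by exact_mod_cast (show 1 ≤ D by omega)
      have hDl : (D : ℝ) ^ 3 ≤ l := hlD
      -- `‖F l‖ ≤ τ(l)/l ≤ Cd l^{-7/8} ≤ Cd D^{-21/8}`
      have hF1 : ‖F l‖ ≤ Cd * (l : ℝ) ^ (1 / 8 : ℝ) / l := by
        simp only [hF]
        rw [norm_div, norm_mul, Complex.norm_natCast]
        refine div_le_div_of_nonneg_right ?_ hl0.le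
        calc ‖vk1 D (l₁ * l)‖ * ‖varrhoJ c' D j l‖ ≤ 1 * (l.divisors.card : ℝ) := by
              gcongr
              · exact norm_vk1_le hlog _
              · exact norm_varrhoJ_le c' D j l
          _ ≤ Cd * (l : ℝ) ^ (1 / 8 : ℝ) := by rw [one_mul]; exact hCd l
      have hF2 : Cd * (l : ℝ) ^ (1 / 8 : ℝ) / l = Cd * (l : ℝ) ^ (-(7 / 8) : ℝ) := by
        rw [mul_div_assoc, ← Real.rpow_sub_one hl0.ne']
        all_goals norm_num
      have hF3 : (l : ℝ) ^ (-(7 / 8) : ℝ) ≤ ((D : ℝ) ^ 3) ^ (-(7 / 8) : ℝ) :=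
        Real.rpow_le_rpow_of_nonpos (by positivity) hDl (by norm_num)
      have hF4 : ((D : ℝ) ^ 3) ^ (-(7 / 8) : ℝ) = (D : ℝ) ^ (-(21 / 8) : ℝ) := by
        rw [← Real.rpow_natCast, ← Real.rpow_mul hD0.le]; norm_num
      -- `𝓛⁸ ≤ ε⁻⁸ D^{21/8}` (`log D ≤ D^ε/ε`, `ε = 21/64`)
      have hL : ell D ≤ (D : ℝ) ^ ε / ε := Real.log_le_rpow_div hD0.le (by norm_num)
      have hL8 : ell D ^ 8 ≤ ε⁻¹ ^ 8 * (D : ℝ) ^ ((21 / 8) : ℝ) := by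
        calc ell D ^ 8 ≤ ((D : ℝ) ^ ε / ε) ^ 8 := by gcongr
          _ = ε⁻¹ ^ 8 * ((D : ℝ) ^ ε) ^ 8 := by rw [div_eq_mul_inv, mul_pow, mul_comm]
          _ = ε⁻¹ ^ 8 * (D : ℝ) ^ ((21 / 8) : ℝ) := by
              rw [← Real.rpow_natCast ((D : ℝ) ^ ε), ← Real.rpow_mul hD0.le, hε]; norm_num
      -- `α𝓛 = π/𝓛⁸`
      have haℓ : alpha D * ell D = π / ell D ^ 8 := by
        have h9 : alpha D * ell D ^ 9 = π := by
          rw [alpha, bigP, Real.log_exp, div_mul_cancel₀ _ (pow_ne_zero _ hℓ0.ne')]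
        rw [eq_div_iff (pow_ne_zero _ hℓ0.ne'), ← h9]; ring
      have hDpow : (D : ℝ) ^ (-(21 / 8) : ℝ) = ((D : ℝ) ^ ((21 / 8) : ℝ))⁻¹ := by
        rw [← Real.rpow_neg hD0.le]
      have hD218 : 0 < (D : ℝ) ^ ((21 / 8) : ℝ) := Real.rpow_pos_of_pos hD0 _
      calc ‖F l‖ ≤ Cd * (l : ℝ) ^ (-(7 / 8) : ℝ) := by rw [← hF2]; exact hF1
        _ ≤ Cd * (D : ℝ) ^ (-(21 / 8) : ℝ) := by
            rw [← hF4]; exact mul_le_mul_of_nonneg_left hF3 (by linarith)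
        _ = Cd * ((D : ℝ) ^ ((21 / 8) : ℝ))⁻¹ := by rw [hDpow]
        _ ≤ Cd * (ε⁻¹ ^ 8 / ell D ^ 8) := by
            refine mul_le_mul_of_nonneg_left ?_ (by linarith)
            rw [le_div_iff₀ (pow_pos hℓ0 8), inv_mul_le_iff₀ hD218, mul_comm]
            exact hL8
        _ = Cd * ε⁻¹ ^ 8 / π * (π / ell D ^ 8) := by field_simp
        _ = Cd * ε⁻¹ ^ 8 / π * (alpha D * ell D) := by rw [haℓ]
    have hB0 : 0 ≤ Cd * ε⁻¹ ^ 8 / π * (alpha D * ell D) := by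
      have : 0 < alpha D := by
        rw [alpha, bigP, Real.log_exp]; exact div_pos Real.pi_pos (pow_pos hℓ0 _)
      have : 0 ≤ Cd := by linarith
      positivity
    calc ‖∑ l ∈ R₀.filter (fun l : ℕ => ((l₁ * l : ℕ) : ℝ) = y), F l‖
        ≤ ∑ l ∈ R₀.filter (fun l : ℕ => ((l₁ * l : ℕ) : ℝ) = y), ‖F l‖ := norm_sum_le _ _
      _ ≤ (R₀.filter (fun l : ℕ => ((l₁ * l : ℕ) : ℝ) = y)).card • (Cd * ε⁻¹ ^ 8 / π * (alpha D * ell D)) :=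
          Finset.sum_le_card_nsmul _ _ _ hterm
      _ ≤ 1 • (Cd * ε⁻¹ ^ 8 / π * (alpha D * ell D)) := nsmul_le_nsmul_left hB0 hcard
      _ = Cd * ε⁻¹ ^ 8 / π * (alpha D * ell D) := one_nsmul _
  -- assembly: `trunc − e₁ = (full − e′₁) − (tail − e″₁) − boundary`
  have key : vkSum c' D (fun m => if (m : ℝ) < bigP D ^ (1 / 2 : ℝ) then vk1 D m else 0) j l₁ - e1j j
      = (vkSum c' D (vk1 D) j l₁ - e1pj j) - (tailB3 c' D j l₁ - e1ppj j) -
        ∑ l ∈ R₀.filter (fun l : ℕ => ((l₁ * l : ℕ) : ℝ) = y), F l := by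
    rw [htrunc, hfull, e1j]; ring
  rw [key]
  calc _ ≤ ‖vkSum c' D (vk1 D) j l₁ - e1pj j‖ + ‖tailB3 c' D j l₁ - e1ppj j‖ +
        ‖∑ l ∈ R₀.filter (fun l : ℕ => ((l₁ * l : ℕ) : ℝ) = y), F l‖ := norm_sub_le_of_le
          (norm_sub_le _ _) le_rfl
    _ ≤ C₁ * alpha D * ell D + C₂ * alpha D * ell D + Cd * ε⁻¹ ^ 8 / π * (alpha D * ell D) :=
        add_le_add (add_le_add g₁ g₂) hbd
    _ = (C₁ + C₂ + Cd * ε⁻¹ ^ 8 / π) * alpha D * ell D := by ring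

end MuOne

end Literature.NumberTheory.LFunctions.Zhang2022.Skeleton
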